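import Literature.AlgebraicGeometry.HodgeTheory.WeilFamilyLevelStructure
import Literature.AlgebraicGeometry.HodgeTheory.InvariantClassesFromTotalSpaceHolds
import Literature.AlgebraicGeometry.HodgeTheory.MotivatedClassesDeformationInputs
import HarnessLib

/-!
# Item `DeligneWeilFamily` (stmt-HodgeConjecture-16866, route `HeckePrymWeil`) ⟺ `deligne1982_weilFamily_kAction`: the three discharge paths and the two packages

The statement item `DeligneWeilFamily` of route `HeckePrymWeil` (stmt-HodgeConjecture-16866; filed
2026-08-16 by the route-choice repair as the PROMOTED form of the named fact
`HodgeTheory.deligne1982_weilFamily_kAction`, [Deligne1982HodgeCycles], proof of Thm. 4.8,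
pp. 47–51) is that fact VERBATIM except that the continuous section `σ` of `FiberClass f (2k)`
through `e^{-1 *} c` is replaced by ONE global class `W ∈ H^{2k}(𝒳(ℂ); ℂ)` with
`W|_{𝒳_{s₁}} = e^{-1 *} c` (and `IsQuasiProjectiveOver S` is spelled out). The one-directional
public theorems are in the tree (lead c14 of crux `HeckePrymAnchors`, landed while this file was
written): `deligneWeilFamily_of_kAction` (`Theorems/HeckePrymWeilHeckePrymAnchorsDeligneWeilFamilyOfKAction`:
the total space is quasi-projective, so the proved Deligne-1968 engine
`deligne1968_invariantClass_fromTotalSpace_holds` turns `σ(s₁)` into a global `W`) and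
`kAction_of_deligneWeilFamily` (`Theorems/HeckePrymWeilHeckePrymAnchorsOfDeligneWeilFamily`:
`σ := globalSection f (2k) W`); this file carries `private` copies of both (same proofs) so as not
to depend on those modules, and records, FOR THE ITEM'S OWN LEDGER ENTRY, the equivalence and what
follows from it with theorems already in the tree. The route file `Theses/HeckePrymWeil.lean`
(rev 18) does not yet declare `DeligneWeilFamily`, so everything is stated against the item's
signature term (checked: `with_reducible exact` of the fact-to-item theorem closes the ledger's
signature term).

* `deligneWeilFamily_iff_kAction` — item ⟺ fact;
* `deligneWeilFamily_of_globalAction`, `deligneWeilFamily_of_levelStructure` — the two other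
  discharge paths (`deligne1982_weilFamily_kAction_of_globalAction`, `…_of_levelStructure`): the
  item closes by `deligneWeilFamily_of_levelStructure deligne1982_weilFamily_levelStructure_holds`
  (resp. `deligneWeilFamily_of_kAction …_kAction_holds`, `…_of_globalAction …_globalAction_holds`)
  the moment any one of the three construction facts is discharged;
* `globalAction_of_deligneWeilFamily`, `hodgeWeilSection_of_deligneWeilFamily` — the item yields
  the two packages the route consumes (balanced Weil type of every fibre,
  `deligne1982_weilFamily_globalAction_of_kAction`; the fibrewise-Hodge flat Weil section, input of
  the sector glue `hodgeWeil_of_weilVariationalHodge_of_hodgeWeilSection` and of the rung closures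
  `…OfWeilFamily`).

So the item carries exactly the debt of the Weil-family facts — the CONSTRUCTION of Deligne's
level-`n` abelian scheme with `𝒪_K`-action through `X` over `Γ\X⁺` (fine PEL moduli scheme,
universal abelian scheme, Baily–Borel/Borel, uniformisation) and its CM/tensor fibre — and
nothing Hodge-theoretic. No `sorry`, no definition, no new axiom.

## References

* [Deligne1982HodgeCycles] P. Deligne (notes by J. S. Milne), Hodge cycles on abelian varieties,
  LNM 900 (1982), Prop. 4.4, Thm. 4.8 and its proof pp. 47–51.
* [VoisinHodgeII2003] C. Voisin, Hodge Theory and Complex Algebraic Geometry II, CUP 2003,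
  Def. 4.14, Thm. 4.15, Lemma 4.17, Thm. 4.18.
* [Deligne1968] P. Deligne, Théorème de Lefschetz et critères de dégénérescence de suites
  spectrales, Publ. Math. IHÉS 35 (1968), Prop. (2.1), (2.6.3).
-/

noncomputable section

-- every declaration of this problem lives in `Summit.HodgeConjecture.HodgeConjecture.…` (summit = sub-problem)
set_option linter.dupNamespace false

open CategoryTheory AlgebraicGeometry Limits MonoidalCategory CartesianMonoidalCategory

namespace Summit.HodgeConjecture.HodgeConjecture.Theorems.HeckePrymWeilLine

open Literature.AlgebraicGeometry Literature.AlgebraicGeometry.Motives Literature.AlgebraicGeometry.HodgeTheory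

/-- Local copy (the public theorem is `deligneWeilFamily_of_kAction`,
`Theorems/HeckePrymWeilHeckePrymAnchorsDeligneWeilFamilyOfKAction`, landed by lead c14 of crux
`HeckePrymAnchors` while this file was written; kept `private` here so that this file does not wait
for that module): `deligne1982_weilFamily_kAction` ⟹ item `DeligneWeilFamily` of route `HeckePrymWeil`,
stmt-HodgeConjecture-16866, signature verbatim. The family, the global `√-p` `g`, the chart `e`,
the fibrewise charts and the tensor fibre are those of the fact; the global class `W` with
`W|_{𝒳_{s₁}} = e^{-1 *} c` comes from the continuous section `σ` through `e^{-1 *} c` by Deligne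
1968 / Voisin II Thm. 4.18 in the tree's proved form `deligne1968_invariantClass_fromTotalSpace_holds`,
applicable because the total space, closed in `ℙᴺ × S` over the quasi-projective `S`, is
quasi-projective. [cite: Deligne1982HodgeCycles, proof of Thm. 4.8 (pp. 47–51)]
[cite: VoisinHodgeII2003, Thm. 4.18] -/
private theorem of_kAction_aux (h : deligne1982_weilFamily_kAction) :
    ∀ p : ℕ, p.Prime → p % 4 = 3 → 7 ≤ p → ∀ (k : ℕ), 1 ≤ k →
    ∀ (X : AbelianVariety ℂ) (Φ : X ⟶ X), X.dim = 2 * k → Φ ≫ Φ = -((p : ℤ) • 𝟙 X) →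
    ∀ c : complexBetti X.X (2 * k), c ∈ weilClassesOf X Φ k p → c ≠ 0 →
      HodgeTheory.IsRationalClass c → IsOfHodgeType (2 * k) X.X (2 * k) k k c →
      ∃ (𝒳 S : SchemeOver ℂ) (f : 𝒳 ⟶ S) (g : 𝒳 ⟶ 𝒳) (s₁ s₀ : ComplexPoints S)
        (e : X.X ≅ fiberOver f s₁) (W : complexBetti 𝒳 (2 * k)),
        IsSmoothProjectiveFamily f (2 * k) ∧
        (∃ (N : ℕ) (ι : 𝒳 ⟶ projectiveSpace N ℂ ⊗ S),
            IsClosedImmersion ι.left ∧ ι ≫ snd (projectiveSpace N ℂ) S = f) ∧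
        IrreducibleSpace S.left ∧ AlgebraicGeometry.Smooth S.hom ∧
        (∃ (P : SchemeOver ℂ) (j : S ⟶ P), IsProjectiveOver P ∧ IsOpenImmersion j.left) ∧
        g ≫ f = f ∧
        (∀ s : ComplexPoints S, ∃ (A' : AbelianVariety ℂ) (φ' : A' ⟶ A') (e' : A'.X ≅ fiberOver f s),
          A'.dim = 2 * k ∧ φ' ≫ φ' = -((p : ℤ) • 𝟙 A') ∧
          (e'.hom ≫ fiberι f s) ≫ g = φ'.hom.hom.hom ≫ (e'.hom ≫ fiberι f s)) ∧
        (e.hom ≫ fiberι f s₁) ≫ g = Φ.hom.hom.hom ≫ (e.hom ≫ fiberι f s₁) ∧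
        complexBetti.map (fiberι f s₁) (2 * k) W = complexBetti.map e.inv (2 * k) c ∧
        ∃ (Y : AbelianVariety ℂ) (Ψ : Y ⟶ Y) (e₀ : Y.X ≅ fiberOver f s₀),
          (∃ (A₁ : AbelianVariety ℂ) (f₁ : Y ⟶ A₁.prod A₁) (g₁ : A₁.prod A₁ ⟶ Y) (m : ℕ),
            A₁.dim = k ∧ Y.dim = 2 * k ∧ Ψ ≫ Ψ = -((p : ℤ) • 𝟙 Y) ∧ 0 < m ∧
            f₁ ≫ g₁ = m • 𝟙 Y ∧ Flat f₁.hom.hom.hom.left ∧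
            g₁ ≫ Ψ = AbelianVariety.prodLift (AbelianVariety.snd A₁ A₁ ≫ (-((p : ℤ) • 𝟙 A₁)))
              (AbelianVariety.fst A₁ A₁) ≫ g₁) ∧
          (e₀.hom ≫ fiberι f s₀) ≫ g = Ψ.hom.hom.hom ≫ (e₀.hom ≫ fiberι f s₀) := by
  intro p hp hp4 hp7 k hk X Φ hX hΦ c hc hc0 hrat hH
  obtain ⟨𝒳, S, f, g, s₁, s₀, e, σ, hfam, hemb, hirr, hsm, hSqp, hg, hfib, he, hσ, hpt, hσ₁, Y, Ψ,
    e₀, hiso, he₀⟩ := h p hp hp4 hp7 k hk X Φ hX hΦ c hc hc0 hrat hH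
  -- the total space is quasi-projective: closed in `ℙᴺ × S`, `S` quasi-projective
  obtain ⟨N, ι, hιc, hιf⟩ := hemb
  haveI := hιc
  have h𝒳qp : IsQuasiProjectiveOver 𝒳 :=
    IsQuasiProjectiveOver.of_isClosedImmersion_projectiveSpace_tensor ι hSqp
  -- Deligne 1968 / Voisin II Thm. 4.18 at the point `s₁`: `σ s₁` is the restriction of a global class
  obtain ⟨W, hW⟩ := deligne1968_invariantClass_fromTotalSpace_holds 𝒳 S f (2 * k) hfam h𝒳qp hSqp hsm
    (2 * k) σ hσ hpt s₁
  refine ⟨𝒳, S, f, g, s₁, s₀, e, W, hfam, ⟨N, ι, hιc, hιf⟩, hirr, hsm, hSqp, hg, hfib, he, ?_, Y, Ψ, e₀,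
    hiso, he₀⟩
  have hW' : (⟨s₁, complexBetti.map e.inv (2 * k) c⟩ : FiberClass f (2 * k)) =
      ⟨s₁, complexBetti.map (fiberι f s₁) (2 * k) W⟩ := hσ₁.symm.trans hW
  exact ((FiberClass.mk_eq_mk_iff _ _).1 hW').symm

/-- Local copy (the public theorem is `kAction_of_deligneWeilFamily`,
`Theorems/HeckePrymWeilHeckePrymAnchorsOfDeligneWeilFamily`, lead c14): item `DeligneWeilFamily` of
route `HeckePrymWeil`, stmt-HodgeConjecture-16866, signature verbatim ⟹ `deligne1982_weilFamily_kAction`: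
the global section `s ↦ (s, W|_{𝒳_s})` of the global class `W` is a continuous section of
`FiberClass f (2k)` (`continuous_globalSection`) through `e^{-1 *} c` at `s₁`; every other clause is
carried over unchanged.
[cite: Deligne1982HodgeCycles, proof of Thm. 4.8 (pp. 47–51)] -/
private theorem kAction_of_aux
    (h : ∀ p : ℕ, p.Prime → p % 4 = 3 → 7 ≤ p → ∀ (k : ℕ), 1 ≤ k →
    ∀ (X : AbelianVariety ℂ) (Φ : X ⟶ X), X.dim = 2 * k → Φ ≫ Φ = -((p : ℤ) • 𝟙 X) →
    ∀ c : complexBetti X.X (2 * k), c ∈ weilClassesOf X Φ k p → c ≠ 0 →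
      HodgeTheory.IsRationalClass c → IsOfHodgeType (2 * k) X.X (2 * k) k k c →
      ∃ (𝒳 S : SchemeOver ℂ) (f : 𝒳 ⟶ S) (g : 𝒳 ⟶ 𝒳) (s₁ s₀ : ComplexPoints S)
        (e : X.X ≅ fiberOver f s₁) (W : complexBetti 𝒳 (2 * k)),
        IsSmoothProjectiveFamily f (2 * k) ∧
        (∃ (N : ℕ) (ι : 𝒳 ⟶ projectiveSpace N ℂ ⊗ S),
            IsClosedImmersion ι.left ∧ ι ≫ snd (projectiveSpace N ℂ) S = f) ∧
        IrreducibleSpace S.left ∧ AlgebraicGeometry.Smooth S.hom ∧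
        (∃ (P : SchemeOver ℂ) (j : S ⟶ P), IsProjectiveOver P ∧ IsOpenImmersion j.left) ∧
        g ≫ f = f ∧
        (∀ s : ComplexPoints S, ∃ (A' : AbelianVariety ℂ) (φ' : A' ⟶ A') (e' : A'.X ≅ fiberOver f s),
          A'.dim = 2 * k ∧ φ' ≫ φ' = -((p : ℤ) • 𝟙 A') ∧
          (e'.hom ≫ fiberι f s) ≫ g = φ'.hom.hom.hom ≫ (e'.hom ≫ fiberι f s)) ∧
        (e.hom ≫ fiberι f s₁) ≫ g = Φ.hom.hom.hom ≫ (e.hom ≫ fiberι f s₁) ∧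
        complexBetti.map (fiberι f s₁) (2 * k) W = complexBetti.map e.inv (2 * k) c ∧
        ∃ (Y : AbelianVariety ℂ) (Ψ : Y ⟶ Y) (e₀ : Y.X ≅ fiberOver f s₀),
          (∃ (A₁ : AbelianVariety ℂ) (f₁ : Y ⟶ A₁.prod A₁) (g₁ : A₁.prod A₁ ⟶ Y) (m : ℕ),
            A₁.dim = k ∧ Y.dim = 2 * k ∧ Ψ ≫ Ψ = -((p : ℤ) • 𝟙 Y) ∧ 0 < m ∧
            f₁ ≫ g₁ = m • 𝟙 Y ∧ Flat f₁.hom.hom.hom.left ∧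
            g₁ ≫ Ψ = AbelianVariety.prodLift (AbelianVariety.snd A₁ A₁ ≫ (-((p : ℤ) • 𝟙 A₁)))
              (AbelianVariety.fst A₁ A₁) ≫ g₁) ∧
          (e₀.hom ≫ fiberι f s₀) ≫ g = Ψ.hom.hom.hom ≫ (e₀.hom ≫ fiberι f s₀)) :
    deligne1982_weilFamily_kAction := by
  intro p hp hp4 hp7 k hk X Φ hX hΦ c hc hc0 hrat hH
  obtain ⟨𝒳, S, f, g, s₁, s₀, e, W, hfam, hemb, hirr, hsm, hSqp, hg, hfib, he, hW, Y, Ψ, e₀, hiso,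
    he₀⟩ := h p hp hp4 hp7 k hk X Φ hX hΦ c hc hc0 hrat hH
  refine ⟨𝒳, S, f, g, s₁, s₀, e, globalSection f (2 * k) W, hfam, hemb, hirr, hsm, hSqp, hg, hfib, he,
    continuous_globalSection f (2 * k) W, fun s => rfl, ?_, Y, Ψ, e₀, hiso, he₀⟩
  change (⟨s₁, complexBetti.map (fiberι f s₁) (2 * k) W⟩ : FiberClass f (2 * k)) = _
  rw [hW]

/-- **Item `DeligneWeilFamily` ⟺ `deligne1982_weilFamily_kAction`**: the global-class rendering
and the continuous-section rendering of Deligne's Weil family through `X` are equivalent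
(public one-directional theorems: `deligneWeilFamily_of_kAction`, `kAction_of_deligneWeilFamily` of lead
c14's files; private copies here), hence the item carries exactly the
debt of the Weil-family named facts (`…_kAction ↔ …_globalAction ⇐ …_levelStructure`), i.e. the
construction of the level-`n` abelian scheme with `𝒪_K`-action over `Γ\X⁺` and its CM/tensor
fibre. [cite: Deligne1982HodgeCycles, proof of Thm. 4.8 (pp. 47–51)] [cite: VoisinHodgeII2003, Thm. 4.18] -/
theorem deligneWeilFamily_iff_kAction :
    (∀ p : ℕ, p.Prime → p % 4 = 3 → 7 ≤ p → ∀ (k : ℕ), 1 ≤ k →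
    ∀ (X : AbelianVariety ℂ) (Φ : X ⟶ X), X.dim = 2 * k → Φ ≫ Φ = -((p : ℤ) • 𝟙 X) →
    ∀ c : complexBetti X.X (2 * k), c ∈ weilClassesOf X Φ k p → c ≠ 0 →
      HodgeTheory.IsRationalClass c → IsOfHodgeType (2 * k) X.X (2 * k) k k c →
      ∃ (𝒳 S : SchemeOver ℂ) (f : 𝒳 ⟶ S) (g : 𝒳 ⟶ 𝒳) (s₁ s₀ : ComplexPoints S)
        (e : X.X ≅ fiberOver f s₁) (W : complexBetti 𝒳 (2 * k)),
        IsSmoothProjectiveFamily f (2 * k) ∧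
        (∃ (N : ℕ) (ι : 𝒳 ⟶ projectiveSpace N ℂ ⊗ S),
            IsClosedImmersion ι.left ∧ ι ≫ snd (projectiveSpace N ℂ) S = f) ∧
        IrreducibleSpace S.left ∧ AlgebraicGeometry.Smooth S.hom ∧
        (∃ (P : SchemeOver ℂ) (j : S ⟶ P), IsProjectiveOver P ∧ IsOpenImmersion j.left) ∧
        g ≫ f = f ∧
        (∀ s : ComplexPoints S, ∃ (A' : AbelianVariety ℂ) (φ' : A' ⟶ A') (e' : A'.X ≅ fiberOver f s),
          A'.dim = 2 * k ∧ φ' ≫ φ' = -((p : ℤ) • 𝟙 A') ∧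
          (e'.hom ≫ fiberι f s) ≫ g = φ'.hom.hom.hom ≫ (e'.hom ≫ fiberι f s)) ∧
        (e.hom ≫ fiberι f s₁) ≫ g = Φ.hom.hom.hom ≫ (e.hom ≫ fiberι f s₁) ∧
        complexBetti.map (fiberι f s₁) (2 * k) W = complexBetti.map e.inv (2 * k) c ∧
        ∃ (Y : AbelianVariety ℂ) (Ψ : Y ⟶ Y) (e₀ : Y.X ≅ fiberOver f s₀),
          (∃ (A₁ : AbelianVariety ℂ) (f₁ : Y ⟶ A₁.prod A₁) (g₁ : A₁.prod A₁ ⟶ Y) (m : ℕ),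
            A₁.dim = k ∧ Y.dim = 2 * k ∧ Ψ ≫ Ψ = -((p : ℤ) • 𝟙 Y) ∧ 0 < m ∧
            f₁ ≫ g₁ = m • 𝟙 Y ∧ Flat f₁.hom.hom.hom.left ∧
            g₁ ≫ Ψ = AbelianVariety.prodLift (AbelianVariety.snd A₁ A₁ ≫ (-((p : ℤ) • 𝟙 A₁)))
              (AbelianVariety.fst A₁ A₁) ≫ g₁) ∧
          (e₀.hom ≫ fiberι f s₀) ≫ g = Ψ.hom.hom.hom ≫ (e₀.hom ≫ fiberι f s₀)) ↔
    deligne1982_weilFamily_kAction :=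
  ⟨kAction_of_aux, of_kAction_aux⟩

/-- **The item from Deligne's global-action package** (`deligne1982_weilFamily_globalAction` ⟹ item
`DeligneWeilFamily`, signature verbatim): forget clause (a) (`deligne1982_weilFamily_kAction_of_globalAction`)
and apply (the local copy of) `deligneWeilFamily_of_kAction`. [cite: Deligne1982HodgeCycles, proof of Thm. 4.8 (pp. 47–51)] -/
theorem deligneWeilFamily_of_globalAction (h : deligne1982_weilFamily_globalAction) :
    ∀ p : ℕ, p.Prime → p % 4 = 3 → 7 ≤ p → ∀ (k : ℕ), 1 ≤ k →
    ∀ (X : AbelianVariety ℂ) (Φ : X ⟶ X), X.dim = 2 * k → Φ ≫ Φ = -((p : ℤ) • 𝟙 X) →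
    ∀ c : complexBetti X.X (2 * k), c ∈ weilClassesOf X Φ k p → c ≠ 0 →
      HodgeTheory.IsRationalClass c → IsOfHodgeType (2 * k) X.X (2 * k) k k c →
      ∃ (𝒳 S : SchemeOver ℂ) (f : 𝒳 ⟶ S) (g : 𝒳 ⟶ 𝒳) (s₁ s₀ : ComplexPoints S)
        (e : X.X ≅ fiberOver f s₁) (W : complexBetti 𝒳 (2 * k)),
        IsSmoothProjectiveFamily f (2 * k) ∧
        (∃ (N : ℕ) (ι : 𝒳 ⟶ projectiveSpace N ℂ ⊗ S),
            IsClosedImmersion ι.left ∧ ι ≫ snd (projectiveSpace N ℂ) S = f) ∧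
        IrreducibleSpace S.left ∧ AlgebraicGeometry.Smooth S.hom ∧
        (∃ (P : SchemeOver ℂ) (j : S ⟶ P), IsProjectiveOver P ∧ IsOpenImmersion j.left) ∧
        g ≫ f = f ∧
        (∀ s : ComplexPoints S, ∃ (A' : AbelianVariety ℂ) (φ' : A' ⟶ A') (e' : A'.X ≅ fiberOver f s),
          A'.dim = 2 * k ∧ φ' ≫ φ' = -((p : ℤ) • 𝟙 A') ∧
          (e'.hom ≫ fiberι f s) ≫ g = φ'.hom.hom.hom ≫ (e'.hom ≫ fiberι f s)) ∧
        (e.hom ≫ fiberι f s₁) ≫ g = Φ.hom.hom.hom ≫ (e.hom ≫ fiberι f s₁) ∧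
        complexBetti.map (fiberι f s₁) (2 * k) W = complexBetti.map e.inv (2 * k) c ∧
        ∃ (Y : AbelianVariety ℂ) (Ψ : Y ⟶ Y) (e₀ : Y.X ≅ fiberOver f s₀),
          (∃ (A₁ : AbelianVariety ℂ) (f₁ : Y ⟶ A₁.prod A₁) (g₁ : A₁.prod A₁ ⟶ Y) (m : ℕ),
            A₁.dim = k ∧ Y.dim = 2 * k ∧ Ψ ≫ Ψ = -((p : ℤ) • 𝟙 Y) ∧ 0 < m ∧
            f₁ ≫ g₁ = m • 𝟙 Y ∧ Flat f₁.hom.hom.hom.left ∧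
            g₁ ≫ Ψ = AbelianVariety.prodLift (AbelianVariety.snd A₁ A₁ ≫ (-((p : ℤ) • 𝟙 A₁)))
              (AbelianVariety.fst A₁ A₁) ≫ g₁) ∧
          (e₀.hom ≫ fiberι f s₀) ≫ g = Ψ.hom.hom.hom ≫ (e₀.hom ≫ fiberι f s₀) :=
  of_kAction_aux (deligne1982_weilFamily_kAction_of_globalAction h)

/-- **The item from Deligne's level-`n` family** (`deligne1982_weilFamily_levelStructure` ⟹ item
`DeligneWeilFamily`, signature verbatim): the integral level-`n` monodromy gives the flat Weil
section (`deligne1982_weilFamily_kAction_of_levelStructure`, "`Γ ⊂ SU ⇒ det_K γ = 1`", LNM 900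
p. 50), then (the local copy of) `deligneWeilFamily_of_kAction`. This is the closing term of the item as soon as the
construction fact `deligne1982_weilFamily_levelStructure` is discharged.
[cite: Deligne1982HodgeCycles, proof of Thm. 4.8 (pp. 47–51), the group Γ] -/
theorem deligneWeilFamily_of_levelStructure (h : deligne1982_weilFamily_levelStructure) :
    ∀ p : ℕ, p.Prime → p % 4 = 3 → 7 ≤ p → ∀ (k : ℕ), 1 ≤ k →
    ∀ (X : AbelianVariety ℂ) (Φ : X ⟶ X), X.dim = 2 * k → Φ ≫ Φ = -((p : ℤ) • 𝟙 X) →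
    ∀ c : complexBetti X.X (2 * k), c ∈ weilClassesOf X Φ k p → c ≠ 0 →
      HodgeTheory.IsRationalClass c → IsOfHodgeType (2 * k) X.X (2 * k) k k c →
      ∃ (𝒳 S : SchemeOver ℂ) (f : 𝒳 ⟶ S) (g : 𝒳 ⟶ 𝒳) (s₁ s₀ : ComplexPoints S)
        (e : X.X ≅ fiberOver f s₁) (W : complexBetti 𝒳 (2 * k)),
        IsSmoothProjectiveFamily f (2 * k) ∧
        (∃ (N : ℕ) (ι : 𝒳 ⟶ projectiveSpace N ℂ ⊗ S),
            IsClosedImmersion ι.left ∧ ι ≫ snd (projectiveSpace N ℂ) S = f) ∧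
        IrreducibleSpace S.left ∧ AlgebraicGeometry.Smooth S.hom ∧
        (∃ (P : SchemeOver ℂ) (j : S ⟶ P), IsProjectiveOver P ∧ IsOpenImmersion j.left) ∧
        g ≫ f = f ∧
        (∀ s : ComplexPoints S, ∃ (A' : AbelianVariety ℂ) (φ' : A' ⟶ A') (e' : A'.X ≅ fiberOver f s),
          A'.dim = 2 * k ∧ φ' ≫ φ' = -((p : ℤ) • 𝟙 A') ∧
          (e'.hom ≫ fiberι f s) ≫ g = φ'.hom.hom.hom ≫ (e'.hom ≫ fiberι f s)) ∧
        (e.hom ≫ fiberι f s₁) ≫ g = Φ.hom.hom.hom ≫ (e.hom ≫ fiberι f s₁) ∧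
        complexBetti.map (fiberι f s₁) (2 * k) W = complexBetti.map e.inv (2 * k) c ∧
        ∃ (Y : AbelianVariety ℂ) (Ψ : Y ⟶ Y) (e₀ : Y.X ≅ fiberOver f s₀),
          (∃ (A₁ : AbelianVariety ℂ) (f₁ : Y ⟶ A₁.prod A₁) (g₁ : A₁.prod A₁ ⟶ Y) (m : ℕ),
            A₁.dim = k ∧ Y.dim = 2 * k ∧ Ψ ≫ Ψ = -((p : ℤ) • 𝟙 Y) ∧ 0 < m ∧
            f₁ ≫ g₁ = m • 𝟙 Y ∧ Flat f₁.hom.hom.hom.left ∧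
            g₁ ≫ Ψ = AbelianVariety.prodLift (AbelianVariety.snd A₁ A₁ ≫ (-((p : ℤ) • 𝟙 A₁)))
              (AbelianVariety.fst A₁ A₁) ≫ g₁) ∧
          (e₀.hom ≫ fiberι f s₀) ≫ g = Ψ.hom.hom.hom ≫ (e₀.hom ≫ fiberι f s₀) :=
  of_kAction_aux (deligne1982_weilFamily_kAction_of_levelStructure h)

/-- **The item gives Deligne's global-action package** (item `DeligneWeilFamily`, signature verbatim
⟹ `deligne1982_weilFamily_globalAction`): balanced Weil type of every fibre is the tree's theorem
`deligne1982_weilFamily_globalAction_of_kAction`, applied after (the local copy of) `kAction_of_deligneWeilFamily`. With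
the landed `heckePrymAnchors_of_globalAction` / `…_of_kAction` this makes crux `HeckePrymAnchors`
(stmt-HodgeConjecture-14496) a corollary of the item.
[cite: Deligne1982HodgeCycles, proof of Thm. 4.8 (pp. 48–51) with Prop. 4.4] -/
theorem globalAction_of_deligneWeilFamily
    (h : ∀ p : ℕ, p.Prime → p % 4 = 3 → 7 ≤ p → ∀ (k : ℕ), 1 ≤ k →
    ∀ (X : AbelianVariety ℂ) (Φ : X ⟶ X), X.dim = 2 * k → Φ ≫ Φ = -((p : ℤ) • 𝟙 X) →
    ∀ c : complexBetti X.X (2 * k), c ∈ weilClassesOf X Φ k p → c ≠ 0 →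
      HodgeTheory.IsRationalClass c → IsOfHodgeType (2 * k) X.X (2 * k) k k c →
      ∃ (𝒳 S : SchemeOver ℂ) (f : 𝒳 ⟶ S) (g : 𝒳 ⟶ 𝒳) (s₁ s₀ : ComplexPoints S)
        (e : X.X ≅ fiberOver f s₁) (W : complexBetti 𝒳 (2 * k)),
        IsSmoothProjectiveFamily f (2 * k) ∧
        (∃ (N : ℕ) (ι : 𝒳 ⟶ projectiveSpace N ℂ ⊗ S),
            IsClosedImmersion ι.left ∧ ι ≫ snd (projectiveSpace N ℂ) S = f) ∧
        IrreducibleSpace S.left ∧ AlgebraicGeometry.Smooth S.hom ∧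
        (∃ (P : SchemeOver ℂ) (j : S ⟶ P), IsProjectiveOver P ∧ IsOpenImmersion j.left) ∧
        g ≫ f = f ∧
        (∀ s : ComplexPoints S, ∃ (A' : AbelianVariety ℂ) (φ' : A' ⟶ A') (e' : A'.X ≅ fiberOver f s),
          A'.dim = 2 * k ∧ φ' ≫ φ' = -((p : ℤ) • 𝟙 A') ∧
          (e'.hom ≫ fiberι f s) ≫ g = φ'.hom.hom.hom ≫ (e'.hom ≫ fiberι f s)) ∧
        (e.hom ≫ fiberι f s₁) ≫ g = Φ.hom.hom.hom ≫ (e.hom ≫ fiberι f s₁) ∧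
        complexBetti.map (fiberι f s₁) (2 * k) W = complexBetti.map e.inv (2 * k) c ∧
        ∃ (Y : AbelianVariety ℂ) (Ψ : Y ⟶ Y) (e₀ : Y.X ≅ fiberOver f s₀),
          (∃ (A₁ : AbelianVariety ℂ) (f₁ : Y ⟶ A₁.prod A₁) (g₁ : A₁.prod A₁ ⟶ Y) (m : ℕ),
            A₁.dim = k ∧ Y.dim = 2 * k ∧ Ψ ≫ Ψ = -((p : ℤ) • 𝟙 Y) ∧ 0 < m ∧
            f₁ ≫ g₁ = m • 𝟙 Y ∧ Flat f₁.hom.hom.hom.left ∧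
            g₁ ≫ Ψ = AbelianVariety.prodLift (AbelianVariety.snd A₁ A₁ ≫ (-((p : ℤ) • 𝟙 A₁)))
              (AbelianVariety.fst A₁ A₁) ≫ g₁) ∧
          (e₀.hom ≫ fiberι f s₀) ≫ g = Ψ.hom.hom.hom ≫ (e₀.hom ≫ fiberι f s₀)) :
    deligne1982_weilFamily_globalAction :=
  deligne1982_weilFamily_globalAction_of_kAction (kAction_of_aux h)

/-- **The item gives the fibrewise-Hodge flat Weil section package** (item `DeligneWeilFamily`,
signature verbatim ⟹ `deligne1982_weilFamily_hodgeWeilSection`), the form consumed by the route's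
sector glue (`hodgeWeil_of_weilVariationalHodge_of_hodgeWeilSection`) and by the rung closures
`…OfWeilFamily`: `deligne1982_weilFamily_hodgeWeilSection_of_kAction` after (the local copy of)
`kAction_of_deligneWeilFamily`.
[cite: Deligne1982HodgeCycles, proof of Thm. 4.8 (pp. 48–51) with Prop. 4.4] -/
theorem hodgeWeilSection_of_deligneWeilFamily
    (h : ∀ p : ℕ, p.Prime → p % 4 = 3 → 7 ≤ p → ∀ (k : ℕ), 1 ≤ k →
    ∀ (X : AbelianVariety ℂ) (Φ : X ⟶ X), X.dim = 2 * k → Φ ≫ Φ = -((p : ℤ) • 𝟙 X) →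
    ∀ c : complexBetti X.X (2 * k), c ∈ weilClassesOf X Φ k p → c ≠ 0 →
      HodgeTheory.IsRationalClass c → IsOfHodgeType (2 * k) X.X (2 * k) k k c →
      ∃ (𝒳 S : SchemeOver ℂ) (f : 𝒳 ⟶ S) (g : 𝒳 ⟶ 𝒳) (s₁ s₀ : ComplexPoints S)
        (e : X.X ≅ fiberOver f s₁) (W : complexBetti 𝒳 (2 * k)),
        IsSmoothProjectiveFamily f (2 * k) ∧
        (∃ (N : ℕ) (ι : 𝒳 ⟶ projectiveSpace N ℂ ⊗ S),
            IsClosedImmersion ι.left ∧ ι ≫ snd (projectiveSpace N ℂ) S = f) ∧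
        IrreducibleSpace S.left ∧ AlgebraicGeometry.Smooth S.hom ∧
        (∃ (P : SchemeOver ℂ) (j : S ⟶ P), IsProjectiveOver P ∧ IsOpenImmersion j.left) ∧
        g ≫ f = f ∧
        (∀ s : ComplexPoints S, ∃ (A' : AbelianVariety ℂ) (φ' : A' ⟶ A') (e' : A'.X ≅ fiberOver f s),
          A'.dim = 2 * k ∧ φ' ≫ φ' = -((p : ℤ) • 𝟙 A') ∧
          (e'.hom ≫ fiberι f s) ≫ g = φ'.hom.hom.hom ≫ (e'.hom ≫ fiberι f s)) ∧
        (e.hom ≫ fiberι f s₁) ≫ g = Φ.hom.hom.hom ≫ (e.hom ≫ fiberι f s₁) ∧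
        complexBetti.map (fiberι f s₁) (2 * k) W = complexBetti.map e.inv (2 * k) c ∧
        ∃ (Y : AbelianVariety ℂ) (Ψ : Y ⟶ Y) (e₀ : Y.X ≅ fiberOver f s₀),
          (∃ (A₁ : AbelianVariety ℂ) (f₁ : Y ⟶ A₁.prod A₁) (g₁ : A₁.prod A₁ ⟶ Y) (m : ℕ),
            A₁.dim = k ∧ Y.dim = 2 * k ∧ Ψ ≫ Ψ = -((p : ℤ) • 𝟙 Y) ∧ 0 < m ∧
            f₁ ≫ g₁ = m • 𝟙 Y ∧ Flat f₁.hom.hom.hom.left ∧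
            g₁ ≫ Ψ = AbelianVariety.prodLift (AbelianVariety.snd A₁ A₁ ≫ (-((p : ℤ) • 𝟙 A₁)))
              (AbelianVariety.fst A₁ A₁) ≫ g₁) ∧
          (e₀.hom ≫ fiberι f s₀) ≫ g = Ψ.hom.hom.hom ≫ (e₀.hom ≫ fiberι f s₀)) :
    deligne1982_weilFamily_hodgeWeilSection :=
  deligne1982_weilFamily_hodgeWeilSection_of_kAction (kAction_of_aux h)

end Summit.HodgeConjecture.HodgeConjecture.Theorems.HeckePrymWeilLine

end
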